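import Mathlib
import Literature.AlgebraicGeometry.Resolution.RsopMonomialIdeals

/-!
# TropicalLinks / InductiveStep — the discrete valuation rings of a frame

Route `ResolutionOfSingularities/TropicalLinks`, crux `InductiveStep` (stmt-ResolutionOfSingularities-17233),
line `split`, brick L1 (producer brick for the geometric producer `stub_valuativeCharts`).

Setting: `O` is the (regular) local ring of the projective closure `Ȳ` at a point, `K = Frac O` its
function field, and `z₁, …, z_r ∈ O` local equations of the boundary divisors through the point — a
part of a regular system of parameters (`IsRsopPart z`).  For each `l` the local ring of `Ȳ` at the
generic point of the `l`-th divisor is the localization `O_{(z_l)}`; read inside `K` it is the set of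
fractions `a / s` with `s ∉ (z_l)`.

* `tropicalLinks_frameDVR_exists_valuationSubring` — for a prime element `ϖ` of a Noetherian domain
  `O` with fraction field `K`, the fractions `a / s` (`ϖ ∤ s`) form a **valuation subring** `V` of `K`:
  every non-zero `a ∈ O` is `ϖ^m a'` with `ϖ ∤ a'` (`WfDvdMonoid.max_power_factor'`), so for
  `x = ϖ^m a' / (ϖ^n b')` either `x` (`n ≤ m`) or `x⁻¹` (`m ≤ n`) is such a fraction.
* `tropicalLinks_frameDVR_valuation_eq_one` / `…_valuation_lt_one` — elements `s ∉ (ϖ)` have value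
  `1`, and `ϖ` has value `< 1`.
* `tropicalLinks_frameDVR_exists_zpow` — every `x ≠ 0` in `K` is `u · ϖ^c` with `c : ℤ` and
  `v(u) = 1` (the order `c = ord_ϖ(x)`).
* `tropicalLinks_frame_valuationSubring` — **the registered stub**: applied to `ϖ = z_l`, which is a
  prime element of the regular local ring `O` (Matsumura 14.3, `IsRsopPart.prime`), not dividing the
  other members `z_l'` (`IsRsopPart.not_dvd`) nor the units of `O`.

These `V` are the boundary components "through the point" and their valuations the orders of
vanishing used by the line.
-/

-- single-problem summit: the doubled namespace component `ResolutionOfSingularities` is forced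
set_option linter.dupNamespace false

namespace Summit.ResolutionOfSingularities.ResolutionOfSingularities.Theorems

open IsLocalRing Literature.AlgebraicGeometry.Resolution

/-- **Units of a valuation subring, field form.** If `x` and `x⁻¹` both lie in a valuation subring `V`
of `K` and `x ≠ 0`, then `v_V(x) = 1`. [folklore] -/
theorem tropicalLinks_frameDVR_valuation_eq_one_of_mem {K : Type*} [Field K] (V : ValuationSubring K)
    {x : K} (hx0 : x ≠ 0) (hx : x ∈ V) (hx' : x⁻¹ ∈ V) : V.valuation x = 1 := by
  refine le_antisymm ((V.valuation_le_one_iff x).2 hx) ?_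
  rw [← V.valuation.map_one]
  exact (V.valuation_le_iff 1 x).2 ⟨⟨x⁻¹, hx'⟩, inv_mul_cancel₀ hx0⟩

/-- **Non-units of a valuation subring, field form.** If `x` lies in a valuation subring `V` of `K`
but `x⁻¹` does not, then `v_V(x) < 1`. [folklore] -/
theorem tropicalLinks_frameDVR_valuation_lt_one_of_mem {K : Type*} [Field K] (V : ValuationSubring K)
    {x : K} (hx : x ∈ V) (hx' : x⁻¹ ∉ V) : V.valuation x < 1 :=
  lt_of_le_of_ne ((V.valuation_le_one_iff x).2 hx) fun h =>
    hx' (by rw [← V.valuation_le_one_iff, map_inv₀, h, inv_one])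

/-- **The local ring at a prime divisor is a valuation ring.** Let `O` be a Noetherian domain with
fraction field `K` and `ϖ ∈ O` a prime element. Then the fractions `a / s` with `a, s ∈ O`, `ϖ ∤ s`
(the localization `O_{(ϖ)}` read inside `K`) form a valuation subring of `K`: writing the numerator
and denominator of `x ∈ Kˣ` as `ϖ^m a'`, `ϖ^n b'` with `ϖ ∤ a', b'` (finiteness of the `ϖ`-adic
order in a Noetherian domain), `x = ϖ^{m-n} a'/b'` lies in the ring if `n ≤ m` and `x⁻¹` does if
`m ≤ n`. [folklore] -/
theorem tropicalLinks_frameDVR_exists_valuationSubring (O : Type*) [CommRing O] [IsDomain O]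
    [IsNoetherianRing O] (K : Type*) [Field K] [Algebra O K] [IsFractionRing O K] {ϖ : O}
    (hϖ : Prime ϖ) :
    ∃ V : ValuationSubring K, ∀ x : K, x ∈ V ↔
      ∃ (a s : O), s ∉ Ideal.span {ϖ} ∧ x * algebraMap O K s = algebraMap O K a := by
  classical
  have hinj : Function.Injective (algebraMap O K) := IsFractionRing.injective O K
  have hne : ∀ {b : O}, b ≠ 0 → algebraMap O K b ≠ 0 := fun hb =>
    (map_ne_zero_iff _ hinj).2 hb
  have hmem : ∀ s : O, s ∉ Ideal.span {ϖ} ↔ ¬ ϖ ∣ s := fun s => by rw [Ideal.mem_span_singleton]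
  have h1 : (1 : O) ∉ Ideal.span {ϖ} := (hmem 1).2 fun h => hϖ.not_unit (isUnit_of_dvd_one h)
  refine ⟨{ carrier := {x | ∃ (a s : O), s ∉ Ideal.span {ϖ} ∧ x * algebraMap O K s = algebraMap O K a}
            mul_mem' := ?_
            one_mem' := ⟨1, 1, h1, by rw [one_mul]⟩
            add_mem' := ?_
            zero_mem' := ⟨0, 1, h1, by rw [zero_mul, map_zero]⟩
            neg_mem' := ?_
            mem_or_inv_mem' := ?_ }, fun x => Iff.rfl⟩
  · rintro x y ⟨a, s, hs, hx⟩ ⟨b, t, ht, hy⟩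
    refine ⟨a * b, s * t, (hmem _).2 fun h => (hϖ.dvd_or_dvd h).elim ((hmem s).1 hs) ((hmem t).1 ht),
      ?_⟩
    rw [map_mul, map_mul, ← hx, ← hy]
    ring
  · rintro x y ⟨a, s, hs, hx⟩ ⟨b, t, ht, hy⟩
    refine ⟨a * t + b * s, s * t,
      (hmem _).2 fun h => (hϖ.dvd_or_dvd h).elim ((hmem s).1 hs) ((hmem t).1 ht), ?_⟩
    rw [map_add, map_mul, map_mul, map_mul, ← hx, ← hy]
    ring
  · rintro x ⟨a, s, hs, hx⟩
    exact ⟨-a, s, hs, by rw [map_neg, ← hx, neg_mul]⟩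
  · intro x
    rcases eq_or_ne x 0 with rfl | hx0
    · exact Or.inl ⟨0, 1, h1, by rw [zero_mul, map_zero]⟩
    obtain ⟨a, b, hb, rfl⟩ := IsFractionRing.div_surjective (A := O) x
    have hb0 : b ≠ 0 := nonZeroDivisors.ne_zero hb
    have ha0 : a ≠ 0 := by
      rintro rfl
      exact hx0 (by rw [map_zero, zero_div])
    obtain ⟨m, a', ha', rfl⟩ := WfDvdMonoid.max_power_factor' ha0 hϖ.not_unit
    obtain ⟨n, b', hb', rfl⟩ := WfDvdMonoid.max_power_factor' hb0 hϖ.not_unit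
    rcases le_total n m with hnm | hmn
    · -- `x = ϖ^d a' / b'`
      obtain ⟨d, rfl⟩ := Nat.exists_eq_add_of_le hnm
      refine Or.inl ⟨ϖ ^ d * a', b', (hmem _).2 hb', ?_⟩
      rw [div_mul_eq_mul_div, div_eq_iff (hne hb0), ← map_mul, ← map_mul]
      congr 1
      ring
    · -- `x⁻¹ = ϖ^d b' / a'`
      obtain ⟨d, rfl⟩ := Nat.exists_eq_add_of_le hmn
      refine Or.inr ⟨ϖ ^ d * b', a', (hmem _).2 ha', ?_⟩
      rw [inv_div, div_mul_eq_mul_div, div_eq_iff (hne ha0), ← map_mul, ← map_mul]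
      congr 1
      ring

/-- **Elements prime to `ϖ` are units of `O_{(ϖ)}`.** With `V ⊆ K` the ring of fractions `a / s`
(`ϖ ∤ s`), every `s ∈ O` with `s ∉ (ϖ)` has `v_V(s) = 1` (its inverse `1 / s` lies in `V`).
[folklore] -/
theorem tropicalLinks_frameDVR_valuation_eq_one (O : Type*) [CommRing O] [IsDomain O]
    (K : Type*) [Field K] [Algebra O K] [IsFractionRing O K] {ϖ : O} (V : ValuationSubring K)
    (hV : ∀ x : K, x ∈ V ↔
      ∃ (a s : O), s ∉ Ideal.span {ϖ} ∧ x * algebraMap O K s = algebraMap O K a)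
    {s : O} (hs : s ∉ Ideal.span {ϖ}) : V.valuation (algebraMap O K s) = 1 := by
  have hs0 : s ≠ 0 := by
    rintro rfl
    exact hs (zero_mem _)
  have hs0' : algebraMap O K s ≠ 0 := (map_ne_zero_iff _ (IsFractionRing.injective O K)).2 hs0
  have h1 : (1 : O) ∉ Ideal.span {ϖ} := fun h => hs (by simpa using Ideal.mul_mem_right s _ h)
  refine tropicalLinks_frameDVR_valuation_eq_one_of_mem V hs0' ((hV _).2 ⟨s, 1, h1, by simp⟩)
    ((hV _).2 ⟨1, s, hs, ?_⟩)
  rw [map_one, inv_mul_cancel₀ hs0']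

/-- **`ϖ` is a non-unit of `O_{(ϖ)}`.** With `V ⊆ K` the ring of fractions `a / s` (`ϖ ∤ s`) for a
prime element `ϖ` of the domain `O`, `v_V(ϖ) < 1`: if `ϖ⁻¹ = a / s` then `s = ϖ a ∈ (ϖ)`.
[folklore] -/
theorem tropicalLinks_frameDVR_valuation_lt_one (O : Type*) [CommRing O] [IsDomain O]
    (K : Type*) [Field K] [Algebra O K] [IsFractionRing O K] {ϖ : O} (hϖ : Prime ϖ)
    (V : ValuationSubring K)
    (hV : ∀ x : K, x ∈ V ↔
      ∃ (a s : O), s ∉ Ideal.span {ϖ} ∧ x * algebraMap O K s = algebraMap O K a) :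
    V.valuation (algebraMap O K ϖ) < 1 := by
  have hinj : Function.Injective (algebraMap O K) := IsFractionRing.injective O K
  have hϖ0 : algebraMap O K ϖ ≠ 0 := (map_ne_zero_iff _ hinj).2 hϖ.ne_zero
  have h1 : (1 : O) ∉ Ideal.span {ϖ} := fun h =>
    hϖ.not_unit (isUnit_of_dvd_one (Ideal.mem_span_singleton.1 h))
  refine tropicalLinks_frameDVR_valuation_lt_one_of_mem V ((hV _).2 ⟨ϖ, 1, h1, by simp⟩) ?_
  rintro hmem
  obtain ⟨a, s, hs, h⟩ := (hV _).1 hmem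
  rw [inv_mul_eq_iff_eq_mul₀ hϖ0, ← map_mul] at h
  exact hs (Ideal.mem_span_singleton.2 ⟨a, hinj h⟩)

/-- **`ϖ` is a uniformizer: `x = u · ϖ^{ord x}`.** With `V ⊆ K` the ring of fractions `a / s`
(`ϖ ∤ s`) for a prime element `ϖ` of the Noetherian domain `O`, every `x ≠ 0` in `K = Frac O` is
`u · ϖ^c` with `c : ℤ` and `v_V(u) = 1`: write `x = ϖ^m a' / (ϖ^n b')` with `ϖ ∤ a', b'` and take
`u = a'/b'`, `c = m - n`. [folklore] -/
theorem tropicalLinks_frameDVR_exists_zpow (O : Type*) [CommRing O] [IsDomain O] [IsNoetherianRing O]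
    (K : Type*) [Field K] [Algebra O K] [IsFractionRing O K] {ϖ : O} (hϖ : Prime ϖ)
    (V : ValuationSubring K)
    (hV : ∀ x : K, x ∈ V ↔
      ∃ (a s : O), s ∉ Ideal.span {ϖ} ∧ x * algebraMap O K s = algebraMap O K a)
    {x : K} (hx0 : x ≠ 0) :
    ∃ (c : ℤ) (u : K), V.valuation u = 1 ∧ x = u * algebraMap O K ϖ ^ c := by
  classical
  have hinj : Function.Injective (algebraMap O K) := IsFractionRing.injective O K
  have hϖ0 : algebraMap O K ϖ ≠ 0 := (map_ne_zero_iff _ hinj).2 hϖ.ne_zero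
  have hmem : ∀ s : O, s ∉ Ideal.span {ϖ} ↔ ¬ ϖ ∣ s := fun s => by rw [Ideal.mem_span_singleton]
  obtain ⟨a, b, hb, rfl⟩ := IsFractionRing.div_surjective (A := O) x
  have hb0 : b ≠ 0 := nonZeroDivisors.ne_zero hb
  have ha0 : a ≠ 0 := by
    rintro rfl
    exact hx0 (by rw [map_zero, zero_div])
  obtain ⟨m, a', ha', rfl⟩ := WfDvdMonoid.max_power_factor' ha0 hϖ.not_unit
  obtain ⟨n, b', hb', rfl⟩ := WfDvdMonoid.max_power_factor' hb0 hϖ.not_unit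
  refine ⟨(m : ℤ) - n, algebraMap O K a' / algebraMap O K b', ?_, ?_⟩
  · rw [map_div₀, tropicalLinks_frameDVR_valuation_eq_one O K V hV ((hmem _).2 ha'),
      tropicalLinks_frameDVR_valuation_eq_one O K V hV ((hmem _).2 hb'), div_one]
  · rw [zpow_sub₀ hϖ0, zpow_natCast, zpow_natCast, map_mul, map_mul, map_pow, map_pow,
      div_mul_div_comm]
    ring

/-- **The discrete valuation rings of a frame.** Let `O` be a local ring with fraction field `K` and
`z : Fin r → O` a part of a regular system of parameters (so `O` is a regular local ring, hence a
Noetherian domain, and each `z_l` is a prime element, Matsumura 14.3). For each `l` there is a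
valuation subring `V` of `K` — the local ring `O_{(z_l)}` of the `l`-th divisor — whose members are
exactly the fractions `a / s` with `s ∉ (z_l)`, for which `z_l` has value `< 1`, the other members
`z_l'` (`l' ≠ l`, as `z_l ∤ z_l'`) and the units of `O` have value `1`, and every non-zero `x ∈ K`
is `u · z_l^c` with `c : ℤ` (the order of `x` along the divisor) and `v(u) = 1`. [folklore] -/
theorem tropicalLinks_frame_valuationSubring : ∀ (O : Type) [CommRing O] [IsLocalRing O] (K : Type) [Field K] [Algebra O K] [IsFractionRing O K] (r : ℕ) (z : Fin r → O), Literature.AlgebraicGeometry.Resolution.IsRsopPart z → ∀ l : Fin r, ∃ V : ValuationSubring K, (∀ x : K, x ∈ V ↔ ∃ (a s : O), s ∉ Ideal.span {z l} ∧ x * algebraMap O K s = algebraMap O K a) ∧ V.valuation (algebraMap O K (z l)) < 1 ∧ (∀ l' : Fin r, l' ≠ l → V.valuation (algebraMap O K (z l')) = 1) ∧ (∀ u : O, IsUnit u → V.valuation (algebraMap O K u) = 1) ∧ (∀ x : K, x ≠ 0 → ∃ (c : ℤ) (u : K), V.valuation u = 1 ∧ x = u * algebraMap O K (z l) ^ c)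 := by
  intro O _ _ K _ _ _ r z hz l
  haveI := hz.isRegularLocalRing
  haveI : IsDomain O := isDomain_of_isRegularLocalRing O
  have hprime : Prime (z l) := hz.prime l
  obtain ⟨V, hV⟩ := tropicalLinks_frameDVR_exists_valuationSubring O K hprime
  refine ⟨V, hV, tropicalLinks_frameDVR_valuation_lt_one O K hprime V hV, fun l' hl' => ?_,
    fun u hu => ?_, fun x hx => tropicalLinks_frameDVR_exists_zpow O K hprime V hV hx⟩
  · -- `z_l ∤ z_l'` for `l' ≠ l`
    exact tropicalLinks_frameDVR_valuation_eq_one O K V hV fun h =>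
      hz.not_dvd (Ne.symm hl') (Ideal.mem_span_singleton.1 h)
  · -- a prime element divides no unit
    exact tropicalLinks_frameDVR_valuation_eq_one O K V hV fun h =>
      hprime.not_unit (isUnit_of_dvd_unit (Ideal.mem_span_singleton.1 h) hu)

end Summit.ResolutionOfSingularities.ResolutionOfSingularities.Theorems
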